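import Summits.QuantumFields.GaugeBoot.TiltedSiteRPGeometry
import HarnessLib

/-!
# No periodic lattice carries both a tilted diagonal frame and an in-plane site frame (gauge-boot, L3 structural no-go)

HONEST FRAMING (cell `pub-gaugeboot`, page 1 of every file): the venture produces certified bounds
on lattice expectations at stated coupling, gauge group, dimension and torus size; NOT a mass gap,
NOT a continuum limit, NOT a string tension; NOT Yang–Mills-summit-bearing (barriers
`FixedCouplingUltralocality`, `PerturbativeInvisibility`). This module is a small STRUCTURAL result
about the two reflection mechanisms of the lane; it bounds no expectation and discharges nothing else.

The lane's two Osterwalder–Seiler mechanisms on a periodic lattice `(A, e)` (an additive commutative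
site group `A` with marked translations `e : Fin d → A`, `TiltedLatticeGauge.lean`) are driven by two
purely geometric structures:

* a **tilted diagonal frame** `IsTiltedFrame e i j θ P v` (`TiltedRPGeometry.lean`): the mirror
  `x_i ↔ x_j`, the height `v = x_i - x_j (mod 2P)`, both layers `v = 0, P` pointwise fixed — it gives
  DIAGONAL reflection positivity in `x_i = x_j` (`IsTiltedFrame.integral_conj_mul_nonneg`,
  Kazakov–Zheng's third family; instance: the 45°-tilted box of Fröhlich–Israel–Lieb–Simon,
  `isTiltedFrame_tiltedBox`);
* a **site frame** `IsSiteFrame e m σ Q h` (`TiltedSiteRPGeometry.lean`): the reflection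
  `x_m ↦ -x_m`, the height `h = x_m (mod 2Q)`, both layers `h = 0, Q` pointwise fixed — it gives SITE
  reflection positivity in `x_m = 0` (`IsSiteFrame.integral_conj_mul_nonneg`) AND LINK reflection
  positivity in `x_m = ½` (`IsSiteFrame.linkRP_integral_conj_mul_nonneg`), the first two families
  (instances: every axis `m ∉ {i, j}` of even period of the tilted box, `isSiteFrame_tiltedBox`).

**Theorem (`IsTiltedFrame.not_isSiteFrame_inPlane`).** On EVERY periodic lattice `(A, e)` — any
additive commutative group, any marked translations, no finiteness needed — a tilted diagonal frame
for the pair `(i, j)` EXCLUDES a site frame along either in-plane axis `m ∈ {i, j}`, for every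
choice of mirrors, half periods and heights. Equivalently (`IsSiteFrame.not_isTiltedFrame_left/right`)
a lattice with a site frame along `m` carries no tilted diagonal frame in any coordinate plane
containing the axis `m`.

Proof (four lines of torsion arithmetic, `§ Orders`): a site frame along `m` forces `2Q • e_m = 0`
(the layer site `Q • e_m`, of height `Q`, is `σ`-fixed while `σ (Q • e_m) = -Q • e_m`) and
`n • e_m = 0 ⇒ 2Q ∣ n` (the height `h (e_m) = 1` has order `2Q`); a tilted frame forces
`P • e_i = P • e_j` (the layer site `P • e_i`, of height `P`, is `θ`-fixed while `θ (P • e_i) = P • e_j`)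
and `n • e_i = 0 ⇒ 2P ∣ n`. Applying `h` to `P • e_i = P • e_j` gives `2Q ∣ P`; applying `v` to
`2Q • e_m = 0` gives `2P ∣ 2Q`; with `P, Q ≥ 2` these are incompatible.

So the dichotomy the lane established box by box is not an accident of the two families of boxes but
a property of ALL periodic volumes: the tree's `not_isSiteFrame_tiltedBox_inPlane`
(`TiltedBoxAxisRPNegative.lean`; the tilted box, `M_u ≥ 1`) is the instance
`hT := isTiltedFrame_tiltedBox` of the present theorem when `M_v ≥ 2`, and conversely
(`not_isTiltedFrame_cubicTorus`, proved here for EVERY side `L`, any `d`, any pair `i, j`, by the same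
arithmetic with the coordinate `x_j` in place of `h`) the cubic torus `A = (ℤ/L)^d`,
`e_m = Pi.single m 1` — the site group `Site d L` of the tree's `GaugeConfig d L` — carries NO tilted
diagonal frame at all, which is the frame-level form of `DiagonalRPTorusNegative.lean` (there:
diagonal RP itself fails on the cubic torus, at every `β`, `d ≥ 2`). In words: Fröhlich–Israel–Lieb–
Simon's "one takes a periodic box with sides at 45° … at the cost of losing the other RP" (J. Stat.
Phys. 22 (1980) §3) is a theorem about every periodic box, not a feature of theirs: NO finite periodic
volume offers the Osterwalder–Seiler mechanism for Kazakov–Zheng's site/link families along an axis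
`m` and for their diagonal family in a plane containing `m` simultaneously; a bootstrap that wants all
three families as finite-volume theorems must take them from different volumes (hence from the
infinite-volume state: uniqueness, `ClassBStrongCoupling*.lean`, or `d = 2`,
`ClassBTwoDimensional.lean`).

What this module does NOT say: it is a statement about FRAMES (the lane's sufficient structures for
reflection positivity), not about reflection positivity itself. That the corresponding positivity
genuinely fails is the content of the lane's negative theorems (`not_tiltedBox_axisRP`,
`TiltedBoxRedSiteRPNegativeUniform.lean`, `DiagonalRPTorusNegative.lean` ff.: at every `β` for the
closed halves, at small `β` for the reduced halves in `d ≥ 3`), while in `d = 2` reduced-half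
positivity survives the absence of a frame (`TiltedBoxEvenAxisRPTwoDim.lean`).

References: J. Fröhlich, R. Israel, E. H. Lieb, B. Simon, J. Stat. Phys. 22 (1980) 297, §3 (Model
3.1), and Comm. Math. Phys. 62 (1978) 1, Thm. 2.1; K. Osterwalder, E. Seiler, Ann. Phys. 110 (1978)
440, §2; M. Biskup, in LNM 1970 (2009) §5.4–5.5 (torus reflections, the "diagonal torus");
V. Kazakov, Z. Zheng, arXiv:2203.11360 §3.1 (the three reflection-positivity families).
-/

namespace Summit.QuantumFields.GaugeBoot

namespace TiltedRP

variable {A : Type*} [AddCommGroup A] {d : ℕ}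

/-! ## Orders of the marked translations forced by a site frame -/

namespace IsSiteFrame

variable {e : Fin d → A} {k : Fin d} {σ : A →+ A} {Q : ℕ} {h : A →+ ZMod (2 * Q)}
variable (hF : IsSiteFrame e k σ Q h)
include hF

/-- The height of `n • e_k` is `n (mod 2Q)`. -/
theorem height_nsmul_e_self (n : ℕ) : h (n • e k) = (n : ZMod (2 * Q)) := by
  rw [map_nsmul, hF.height_self, nsmul_eq_mul, mul_one]

/-- **A site frame in direction `k` forces `2Q • e_k = 0`**: the layer site `Q • e_k` has height `Q`,
so it is fixed by `σ`, while `σ (Q • e_k) = -(Q • e_k)`. -/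
theorem two_mul_nsmul_e_self : (2 * Q) • e k = 0 := by
  have hfix := hF.fix_of_layer (Q • e k) (Or.inr (hF.height_nsmul_e_self Q))
  rw [map_nsmul, hF.map_e_self, smul_neg, neg_eq_iff_add_eq_zero, ← add_nsmul] at hfix
  rwa [two_mul]

/-- Conversely `n • e_k = 0` only if `2Q ∣ n`: the height `h (e_k) = 1` has additive order `2Q`. -/
theorem two_mul_dvd_of_nsmul_e_self {n : ℕ} (hn : n • e k = 0) : 2 * Q ∣ n := by
  have hh := hF.height_nsmul_e_self n
  rw [hn, map_zero] at hh
  exact (ZMod.natCast_eq_zero_iff _ _).1 hh.symm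

/-- Hence the marked translation `e_k` of a site frame has additive order EXACTLY `2Q`
(site frames live in directions of even period, read off intrinsically). -/
theorem addOrderOf_e_self : addOrderOf (e k) = 2 * Q :=
  Nat.dvd_antisymm (addOrderOf_dvd_of_nsmul_eq_zero hF.two_mul_nsmul_e_self)
    (hF.two_mul_dvd_of_nsmul_e_self (addOrderOf_nsmul_eq_zero (e k)))

end IsSiteFrame

/-! ## Orders of the marked translations forced by a tilted diagonal frame -/

namespace IsTiltedFrame

variable {e : Fin d → A} {i j : Fin d} {θ : A →+ A} {P : ℕ} {v : A →+ ZMod (2 * P)}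
variable (hF : IsTiltedFrame e i j θ P v)
include hF

/-- The height of `n • e_i` is `n (mod 2P)`. -/
theorem height_nsmul_e_left (n : ℕ) : v (n • e i) = (n : ZMod (2 * P)) := by
  rw [map_nsmul, hF.height_left, nsmul_eq_mul, mul_one]

/-- The height of `n • e_j` is `-n (mod 2P)`. -/
theorem height_nsmul_e_right (n : ℕ) : v (n • e j) = -(n : ZMod (2 * P)) := by
  rw [map_nsmul, hF.height_right, smul_neg, nsmul_eq_mul, mul_one]

/-- **A tilted diagonal frame forces `P • e_i = P • e_j`**: the layer site `P • e_i` has height `P`,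
so it is fixed by the mirror, while `θ (P • e_i) = P • e_j`. (On the tilted box this is the period
`M_v (e_i - e_j) ∈ Γ`; on the cubic torus it is false, `not_isTiltedFrame_cubicTorus`.) -/
theorem nsmul_e_left_eq_nsmul_e_right : P • e i = P • e j := by
  have hfix := hF.fix_of_layer (P • e i) (Or.inr (hF.height_nsmul_e_left P))
  rw [map_nsmul, hF.map_e i, Equiv.swap_apply_left] at hfix
  exact hfix.symm

/-- Equivalently: `P • (e_i - e_j) = 0` — the diagonal half period is a period of the lattice. -/
theorem nsmul_e_sub_e_eq_zero : P • (e i - e j) = 0 := by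
  rw [smul_sub, hF.nsmul_e_left_eq_nsmul_e_right, sub_self]

/-- `n • e_i = 0` only if `2P ∣ n`: the height `v (e_i) = 1` has additive order `2P`. -/
theorem two_mul_dvd_of_nsmul_e_left {n : ℕ} (hn : n • e i = 0) : 2 * P ∣ n := by
  have hh := hF.height_nsmul_e_left n
  rw [hn, map_zero] at hh
  exact (ZMod.natCast_eq_zero_iff _ _).1 hh.symm

/-- `n • e_j = 0` only if `2P ∣ n`: the height `v (e_j) = -1` has additive order `2P`. -/
theorem two_mul_dvd_of_nsmul_e_right {n : ℕ} (hn : n • e j = 0) : 2 * P ∣ n := by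
  have hh := hF.height_nsmul_e_right n
  rw [hn, map_zero, eq_comm, neg_eq_zero] at hh
  exact (ZMod.natCast_eq_zero_iff _ _).1 hh

/-! ## The no-go: a tilted diagonal frame excludes an in-plane site frame -/

/-- **No site frame along the first in-plane axis.** A periodic lattice with a tilted diagonal frame
for `(i, j)` carries no site frame `IsSiteFrame e i σ Q h` along `i` — for ANY additive reflection
`σ`, half period `Q` and height `h`. (Apply `h` to `P • e_i = P • e_j`: `2Q ∣ P`; apply `v` to
`2Q • e_i = 0`: `2P ∣ 2Q`; impossible for `P, Q ≥ 2`.) -/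
theorem not_isSiteFrame_left {σ : A →+ A} {Q : ℕ} {h : A →+ ZMod (2 * Q)} :
    ¬ IsSiteFrame e i σ Q h := by
  intro hS
  have hP := hF.two_le
  have hQ := hS.two_le
  have h1 : 2 * Q ∣ P := by
    have hh := congrArg h hF.nsmul_e_left_eq_nsmul_e_right
    rw [map_nsmul, map_nsmul, hS.height_self, hS.height_other j hF.ne.symm, smul_zero, nsmul_eq_mul,
      mul_one] at hh
    exact (ZMod.natCast_eq_zero_iff _ _).1 hh
  have h2 : 2 * P ∣ 2 * Q := hF.two_mul_dvd_of_nsmul_e_left hS.two_mul_nsmul_e_self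
  have h3 : 2 * Q ≤ P := Nat.le_of_dvd (by omega) h1
  have h4 : 2 * P ≤ 2 * Q := Nat.le_of_dvd (by omega) h2
  omega

/-- **No site frame along the second in-plane axis** (same arithmetic with `e_j`, `v (e_j) = -1`). -/
theorem not_isSiteFrame_right {σ : A →+ A} {Q : ℕ} {h : A →+ ZMod (2 * Q)} :
    ¬ IsSiteFrame e j σ Q h := by
  intro hS
  have hP := hF.two_le
  have hQ := hS.two_le
  have h1 : 2 * Q ∣ P := by
    have hh := congrArg h hF.nsmul_e_left_eq_nsmul_e_right
    rw [map_nsmul, map_nsmul, hS.height_other i hF.ne, hS.height_self, smul_zero, nsmul_eq_mul,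
      mul_one] at hh
    exact (ZMod.natCast_eq_zero_iff _ _).1 hh.symm
  have h2 : 2 * P ∣ 2 * Q := hF.two_mul_dvd_of_nsmul_e_right hS.two_mul_nsmul_e_self
  have h3 : 2 * Q ≤ P := Nat.le_of_dvd (by omega) h1
  have h4 : 2 * P ≤ 2 * Q := Nat.le_of_dvd (by omega) h2
  omega

/-- **THE NO-GO.** On every periodic lattice `(A, e)`: a tilted diagonal frame for the pair `(i, j)`
excludes a site frame — hence the tree's site-RP mechanism `IsSiteFrame.integral_conj_mul_nonneg`
AND its link-RP mechanism `IsSiteFrame.linkRP_integral_conj_mul_nonneg` — along BOTH in-plane axes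
`m ∈ {i, j}`, whatever the reflection `σ`, the half period `Q` and the height `h`. The tree's
`not_isSiteFrame_tiltedBox_inPlane` is the instance `isTiltedFrame_tiltedBox` (`M_v ≥ 2`). -/
theorem not_isSiteFrame_inPlane {m : Fin d} (hm : m = i ∨ m = j) {σ : A →+ A} {Q : ℕ}
    {h : A →+ ZMod (2 * Q)} : ¬ IsSiteFrame e m σ Q h := by
  rcases hm with rfl | rfl
  exacts [hF.not_isSiteFrame_left, hF.not_isSiteFrame_right]

end IsTiltedFrame

/-! ## The converse reading: an in-plane site frame excludes every tilted diagonal frame -/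

namespace IsSiteFrame

variable {e : Fin d → A} {k : Fin d} {σ : A →+ A} {Q : ℕ} {h : A →+ ZMod (2 * Q)}
variable (hF : IsSiteFrame e k σ Q h)
include hF

/-- A periodic lattice with a site frame along `k` carries no tilted diagonal frame for any pair
`(k, j)`: no mirror `θ`, half period `P`, height `v` will do. -/
theorem not_isTiltedFrame_left (j : Fin d) {θ : A →+ A} {P : ℕ} {v : A →+ ZMod (2 * P)} :
    ¬ IsTiltedFrame e k j θ P v :=
  fun hT => hT.not_isSiteFrame_left hF

/-- A periodic lattice with a site frame along `k` carries no tilted diagonal frame for any pair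
`(i, k)`. -/
theorem not_isTiltedFrame_right (i : Fin d) {θ : A →+ A} {P : ℕ} {v : A →+ ZMod (2 * P)} :
    ¬ IsTiltedFrame e i k θ P v :=
  fun hT => hT.not_isSiteFrame_right hF

/-- Both orders at once: no tilted diagonal frame in any coordinate plane through the axis `k`. -/
theorem not_isTiltedFrame_of_mem {i j : Fin d} (hk : k = i ∨ k = j) {θ : A →+ A} {P : ℕ}
    {v : A →+ ZMod (2 * P)} : ¬ IsTiltedFrame e i j θ P v :=
  fun hT => hT.not_isSiteFrame_inPlane hk hF

end IsSiteFrame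

/-! ## The cubic torus carries no tilted diagonal frame (every side `L`) -/

/-- **The cubic torus `(ℤ/L)^d` has no tilted diagonal frame** — for EVERY side `L` (even, odd, or
the degenerate `L = 0`, i.e. `ℤ^d` itself), every dimension `d`, every pair of axes `i, j`, every
additive mirror `θ`, half period `P` and height `v` — in the presentation `A = Site d L = (Fin d → ℤ/L)`,
`e_m = Pi.single m 1` of the tree's `GaugeConfig d L`. Reason: a frame forces `P • e_i = P • e_j`,
whose `j`-th coordinate reads `L ∣ P`, and `L • e_i = 0` forces `2P ∣ L`. This is the frame-level
form of `DiagonalRPTorusNegative.lean` (where diagonal RP itself is refuted on the cubic torus): the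
Osterwalder–Seiler route to Kazakov–Zheng's diagonal family is closed on every cubic torus, not only
for the particular mirror and half used there. -/
theorem not_isTiltedFrame_cubicTorus (L : ℕ) (i j : Fin d)
    (θ : (Fin d → ZMod L) →+ (Fin d → ZMod L)) (P : ℕ) (v : (Fin d → ZMod L) →+ ZMod (2 * P)) :
    ¬ IsTiltedFrame (fun m : Fin d => (Pi.single m (1 : ZMod L) : Fin d → ZMod L)) i j θ P v := by
  intro hF
  have hP := hF.two_le
  -- `L ∣ P`: the `j`-th coordinate of `P • e_i = P • e_j`
  have h1 : L ∣ P := by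
    have hh := congrFun hF.nsmul_e_left_eq_nsmul_e_right j
    simp only [Pi.smul_apply, Pi.single_eq_same, Pi.single_eq_of_ne hF.ne.symm, smul_zero,
      nsmul_eq_mul, mul_one] at hh
    exact (ZMod.natCast_eq_zero_iff _ _).1 hh.symm
  -- `2P ∣ L`: `L • e_i = 0`
  have h2 : 2 * P ∣ L := by
    refine hF.two_mul_dvd_of_nsmul_e_left ?_
    funext m
    simp only [Pi.smul_apply, Pi.zero_apply]
    rw [nsmul_eq_mul, ZMod.natCast_self, zero_mul]
  rcases Nat.eq_zero_or_pos L with rfl | hL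
  · have := Nat.eq_zero_of_zero_dvd h1
    omega
  · have h3 : L ≤ P := Nat.le_of_dvd (by omega) h1
    have h4 : 2 * P ≤ L := Nat.le_of_dvd hL h2
    omega

end TiltedRP

end Summit.QuantumFields.GaugeBoot
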